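import Summits.Ventures.CertifiedManyBodySolver.Downfold.EmeryScaleBoxNCCONH085E7
import HarnessLib

/-!
# Telescoped ceiling-edge data and per-cell kernel checks (part 8) for the scale coordinate over the NCCO (K) #24 source box `emeryBoxNCCOK26Src (EmeryBoxesKSlicesB)` (Nd₂₋ₓCeₓCuO₄, x = 0.15, electron-doped), ν = 23/40 (INFL-3to1-B §B.91)

Venture CertifiedManyBodySolver, cell `pub/hubbard-downfold` (stage S1; INFLATION-RULES-3to1-B §B.91), seat hubbard-downfold-mod-4 (technique B = band
level, g40); namespace `Summit.Ventures.CertifiedManyBodySolver.Downfold.Emery`. Everything PROVED (`decide +kernel` per kernel unit). WHAT THIS IS NOT: a statement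
about the material — the box is SCREENING-GRADE (typed from a printed three-band set); `U = 0` one-body kinematics of the σ model.
Part 8: `ECellS` data of the extended ceiling edge Δ′ ∈ [1, 2.9385] (a₂ = 1.29, b₂ = 0.72, c = 0.02): per Δ′-cell its bracket window, value-check depth, t_pp stage (§B.88 cells) and oxygen-hopping RAY stages (Lipschitz transport, `rayCellCheckL`), each kernel unit ≤ 1500 leaves; `edgeCellOKL … = true` and `sCondL … = true` per cell. Value bound V/SC = 0.534411 eV.
Generator HOME/hubbard-downfold-mod-4/edge-g40/gen/emit_ncco.py (bit-exact mirror efi.py of the kernel checkers `EmeryScaleRayCellL` / `EmeryScaleEdgeChainL` /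
`EmeryScaleEdgeBoxL`, on scale-g36/gen/fi.py).

Sources: three-band model [HybertsenSchluterChristensen1989, Eq. (1)]; energy-linearised one-band image [AndersenEtAl1995, §6]; interval arithmetic
[folklore] (Moore 1966).
-/

namespace Summit.Ventures.CertifiedManyBodySolver.Downfold.Emery

open Real Set Literature.Analysis.ValidatedNumerics.Numerics

/-- Ceiling-edge cell 28 passes (one kernel unit, ≈ 267 leaves). [folklore] -/
theorem eE_NCCONH085_28_ok : edgeCellOKL true ⟨5629499534213, 5629499534214⟩ ⟨363102719956746, 363102719956747⟩ ⟨202661983231672, 202661983231673⟩ 56294995342132 117701378885581 121972489907951 150423344961302 497338136350058 eE_NCCONH085_28.cell = true := by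
  decide +kernel

/-- Step-range conditions of cell 28. [folklore] -/
theorem eE_NCCONH085_28_sc : sCondL true 121972489907951 ⟨281474976710656, 281474976710656⟩ ⟨577023702256844, 577023702256845⟩ eE_NCCONH085_28 = true := by
  decide +kernel

end Summit.Ventures.CertifiedManyBodySolver.Downfold.Emery
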